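import Summits.CriticalPhenomena.PercolationContinuityZ3.Theorems.PercNearOneGluingNoHeavyLowerTailAntitheticCycleStairFamily
import HarnessLib

/-!
# `NoHeavyLowerTail` (stmt-CriticalPhenomena-4575) — antithetic cluster pairs: the STAIRCASE FAMILY on a cycle is nonnegative (THEOREM C, file C2c;
# prim-hp-2 gen 39, HOME/THEOREM-C-cycles.md "LEAN BLUEPRINT")

Support file (`--supports stmt-CriticalPhenomena-4575`, hull-port prover `prim-hp-2`, gen 39).  No named facts, no sorries; standard axioms.  The `def`s
`Antithetic.Cyc.{algOf, stairFam, uSet, stairAlg, stairPart}` are proof-internal bookkeeping.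

THE STAIRCASE LEMMA (`Cyc.stairFam_sum_nonneg`): on a cycle through `s` (`n ≥ 3`) and for a position `0 < a < n`, the antithetic sum over the colourings that
CHANGE colour at the vertex `v a` and are NOT one-change there (not both legs monochromatic) is `≥ 0` for all increasing `F, G` of the edge cluster.  This is
the sum that appears when a forbidden vertex `v a ∈ R` is peeled off the cycle (the colourings without a change at `v a` contract to the shorter cycle), so
THEOREM C follows from it by induction (file C3/C4, next).  PROOF: the family is partitioned into staircase pieces (…CycleStair, …CycleStairFamily): for `ω`
with first runs `α = fru ω`, `β = frw ω` the cube leg is `u` if `α < a ∧ (α ≤ β ∨ β = n−a)` (`uSet`), else `w` (handled as the `u`-case of the REFLECTED cycle,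
…CycleReflect); the piece of `ω` is `{M : M ∆ ω respects the labels}`; parts are constant on themselves because members keep the cube leg's first run and
can only lengthen the partner's; each part is the image of its label algebra under `N ∆ ·` for the top colouring `N = topU`, so `Cyc.Stair.sum_nonneg`
applies; `LatticePieces.sum_nonneg_of_parts` concludes.  Machine check of the partition: HOME/code/gen39/lab39/p3rule.py, cyclerule.py.
[cite: VandenbergHaggstromKahn2005, §1 p. 6 ("Harris' inequality")]
-/

noncomputable section

namespace Summit.CriticalPhenomena.PercolationContinuityZ3.Theorems

open Literature.Probability.Percolation
open scoped Classical symmDiff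

namespace Antithetic

namespace Cyc

variable {V : Type*}

/-- Flip sets respecting a labelling `L` of the pairs `ed 0, …, ed (n−1)`. [this work] -/
def algOf (n : ℕ) (L : ℕ → ℕ) (ed : ℕ → Sym2 V) : Set (Set (Sym2 V)) :=
  {A | ∀ i j, i < n → j < n → L i = L j → (ed i ∈ A ↔ ed j ∈ A)}

section AlgOf

variable {n : ℕ} {L : ℕ → ℕ} {ed : ℕ → Sym2 V}

/-- The label algebra contains `∅`. -/
theorem empty_mem_algOf : (∅ : Set (Sym2 V)) ∈ algOf n L ed := fun _ _ _ _ _ => by simp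

/-- The label algebra is closed under symmetric difference. -/
theorem symmDiff_mem_algOf {A B : Set (Sym2 V)} (hA : A ∈ algOf n L ed) (hB : B ∈ algOf n L ed) : A ∆ B ∈ algOf n L ed := by
  intro i j hi hj hl
  rw [Set.mem_symmDiff, Set.mem_symmDiff, hA i j hi hj hl, hB i j hi hj hl]

/-- Pieces as images: `{M : M ∆ ω ∈ 𝒜} = 𝒜.image (N ∆ ·)` whenever `N ∆ ω ∈ 𝒜`. [this work] -/
theorem filter_eq_image [Fintype V] {ω N : Set (Sym2 V)} (hN : N ∆ ω ∈ algOf n L ed) :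
    (Finset.univ.filter fun M : Set (Sym2 V) => M ∆ ω ∈ algOf n L ed) =
      (Finset.univ.filter fun A : Set (Sym2 V) => A ∈ algOf n L ed).image (N ∆ ·) := by
  ext M
  simp only [Finset.mem_filter, Finset.mem_univ, true_and, Finset.mem_image]
  constructor
  · intro hM
    refine ⟨N ∆ M, ?_, symmDiff_symmDiff_cancel_left N M⟩
    have : N ∆ M = (N ∆ ω) ∆ (M ∆ ω) := by
      rw [symmDiff_comm M ω, symmDiff_assoc, symmDiff_symmDiff_cancel_left]
    rw [this]; exact symmDiff_mem_algOf hN hM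
  · rintro ⟨A, hA, rfl⟩
    have : (N ∆ A) ∆ ω = A ∆ (N ∆ ω) := by
      rw [symmDiff_comm N A, symmDiff_assoc]
    rw [this]; exact symmDiff_mem_algOf hA hN

end AlgOf

variable (n : ℕ) (v : ℕ → V) (a : ℕ)

/-- The STAIRCASE FAMILY at position `a`: colourings changing colour at `v a` whose two legs are not both monochromatic. [this work] -/
def stairFam [Fintype V] : Finset (Set (Sym2 V)) :=
  Finset.univ.filter fun ω => ¬ (edge v (a - 1) ∈ ω ↔ edge v a ∈ ω) ∧
    ¬ ((∀ i, i < a → (edge v i ∈ ω ↔ edge v 0 ∈ ω)) ∧ (∀ i, a ≤ i → i < n → (edge v i ∈ ω ↔ edge v (n - 1) ∈ ω)))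

/-- Colourings whose staircase piece has cube leg `u`. [this work] -/
def uSet : Set (Set (Sym2 V)) := {ω | fru n v a ω < a ∧ (fru n v a ω ≤ frw n v a ω ∨ frw n v a ω = n - a)}

/-- The label algebra of the staircase piece of `ω` (orientation by `uSet`; the `w`-orientation is the `u`-orientation of the reflected cycle). [this work] -/
def stairAlg (ω : Set (Sym2 V)) : Set (Set (Sym2 V)) :=
  if ω ∈ uSet n v a then algOf n (lab n a (fru n v a ω) (min (fru n v a ω) (n - a + 1))) (edge v)
  else algOf n (lab n (n - a) (frw n v a ω) (min (frw n v a ω + 1) (a + 1))) (edge fun i => v (n - i))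

/-- The staircase piece of `ω`. [this work] -/
def stairPart [Fintype V] (ω : Set (Sym2 V)) : Finset (Set (Sym2 V)) :=
  Finset.univ.filter fun M => M ∆ ω ∈ stairAlg n v a ω

variable {n v a} (hn : 3 ≤ n) (hinj : ∀ i j, i < n → j < n → v i = v j → i = j) (hper : v n = v 0) (ha0 : 0 < a) (han : a < n)

section Lemmas

include ha0 han in
/-- A monochromatic initial segment of `u` bounds `fru` from below. -/
theorem le_fru (ω : Set (Sym2 V)) {t : ℕ} (hta : t ≤ a) (hrun : ∀ i, i < t → (edge v i ∈ ω ↔ edge v 0 ∈ ω)) : t ≤ fru n v a ω := by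
  obtain ⟨-, hle, -, hstop⟩ := fru_spec ha0 han ω
  by_contra hlt
  push Not at hlt
  exact hstop (by omega) (hrun _ hlt)

include ha0 han in
/-- `frw` as `fru` of the reflected cycle, and back. -/
theorem frw_reflect (ω : Set (Sym2 V)) : frw n (fun i => v (n - i)) (n - a) ω = fru n v a ω := by
  unfold frw fru
  rw [suf_reflect ω, suf_reflect ωᶜ, show n - (n - a) = a by omega]

include ha0 han in
/-- For `ω` in the family outside `uSet`, the cube leg `w` is mixed and its run is shorter than `u`'s. -/
theorem w_case {ω : Set (Sym2 V)} (hfam : ¬ ((∀ i, i < a → (edge v i ∈ ω ↔ edge v 0 ∈ ω)) ∧ (∀ i, a ≤ i → i < n → (edge v i ∈ ω ↔ edge v (n - 1) ∈ ω))))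
    (hu : ω ∉ uSet n v a) : frw n v a ω < n - a ∧ (min (frw n v a ω + 1) (a + 1) ≤ fru n v a ω ∨ fru n v a ω = a) := by
  obtain ⟨h1, hle, hrun, hstop⟩ := fru_spec ha0 han ω
  obtain ⟨h1', hle', hrun', hstop'⟩ := fru_spec (n := n) (v := fun i => v (n - i)) (a := n - a) (by omega) (by omega) ω
  rw [← frw_eq_fru_reflect] at hle' hrun' hstop' h1'
  simp only [uSet, Set.mem_setOf_eq, not_and_or, not_or, not_le] at hu
  have hwmix : frw n v a ω < n - a := by
    rcases hu with hu | ⟨hu1, hu2⟩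
    · -- u is pure: then w is not monochromatic
      have hfa : fru n v a ω = a := le_antisymm hle (not_lt.1 hu)
      by_contra hw
      have hfw : frw n v a ω = n - a := le_antisymm hle' (not_lt.1 hw)
      apply hfam
      refine ⟨fun i hi => hrun i (by omega), fun i hai hin => ?_⟩
      have := hrun' (n - 1 - i) (by omega)
      rwa [edge_reflect (by omega), edge_reflect (by omega), show n - 1 - (n - 1 - i) = i by omega, Nat.sub_zero] at this
    · omega
  refine ⟨hwmix, ?_⟩
  rcases hu with hu | ⟨hu1, hu2⟩
  · exact Or.inr (le_antisymm hle (not_lt.1 hu))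
  · left; exact (Nat.min_le_left _ _).trans (by omega)

end Lemmas

section Main

variable [Fintype V]
include hn hinj hper ha0 han

/-- The top colouring of `ω`'s piece differs from `ω` by a label-respecting set, in either orientation. -/
theorem top_mem_alg {ω : Set (Sym2 V)} (hω : ω ∈ stairFam n v a) :
    (ω ∈ uSet n v a → topU n v a (fru n v a ω) ω ∆ ω ∈ stairAlg n v a ω) ∧
    (ω ∉ uSet n v a → topU n (fun i => v (n - i)) (n - a) (frw n v a ω) ω ∆ ω ∈ stairAlg n v a ω) := by
  rw [stairFam, Finset.mem_filter] at hω
  obtain ⟨-, hchg, hfam⟩ := hω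
  constructor
  · intro hu
    rw [stairAlg, if_pos hu]
    have hu' := hu
    simp only [uSet, Set.mem_setOf_eq] at hu'
    exact topU_resp hn hinj hper ha0 han (fru n v a ω) (fru_spec ha0 han ω).1 hu'.1 ω hchg rfl hu'.2
  · intro hu
    rw [stairAlg, if_neg hu]
    obtain ⟨hwmix, hw⟩ := w_case ha0 han hfam hu
    have h1 : 1 ≤ frw n v a ω := by
      have := (fru_spec (n := n) (v := fun i => v (n - i)) (a := n - a) (by omega) (by omega) ω).1
      rwa [← frw_eq_fru_reflect] at this
    refine topU_resp_gen hn (reflect_inj hinj hper) (reflect_per hper) (by omega) (by omega) (frw n v a ω) h1 hwmix ω ?_ ?_ (by omega) ?_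
    · rw [edge_reflect (by omega), edge_reflect (by omega), show n - 1 - (n - a - 1) = a by omega, show n - 1 - (n - a) = a - 1 by omega]
      exact fun h => hchg h.symm
    · exact (frw_eq_fru_reflect ω).symm
    · rw [frw_reflect ha0 han, show n - (n - a) = a by omega]; exact hw

omit [Fintype V] hn hinj hper in
/-- A monochromatic initial segment of `w` bounds `frw` from below. -/
theorem le_frw (ω : Set (Sym2 V)) {t : ℕ} (htq : t ≤ n - a) (hrun : ∀ j, j < t → (edge v (n - 1 - j) ∈ ω ↔ edge v (n - 1) ∈ ω)) :
    t ≤ frw n v a ω := by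
  rw [frw_eq_fru_reflect]
  refine le_fru (n := n) (v := fun i => v (n - i)) (a := n - a) (by omega) (by omega) ω htq fun j hj => ?_
  rw [edge_reflect (by omega), edge_reflect (by omega), Nat.sub_zero]
  exact hrun j hj

omit [Fintype V] hn hinj hper ha0 han in
/-- **Generic member facts in one orientation.**  Cycle data `(n, w)` with position `b`, a top `N` of the staircase piece with run `k` and partner tie
length `m`, and a member `M = N ∆ A`: `M` changes colour at `b`, `fru M = k`, the first `min m (n−b)` letters of the other leg are monochromatic in `M`,
and the `u`-leg of `M` is not monochromatic. [this work] -/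
theorem member_generic {w : ℕ → V} {b k m : ℕ}
    (hb0 : 0 < b) (hbn : b < n) (hk1 : 1 ≤ k) (hkb : k < b) (N A : Set (Sym2 V))
    (hN0 : ∀ i, i < k → edge w i ∈ N) (hNk : edge w k ∉ N) (hNw : ∀ i, b ≤ i → i < n → edge w i ∈ N) (hNa : edge w (b - 1) ∉ N)
    (hA : A ∈ algOf n (lab n b k m) (edge w)) :
    ¬ (edge w (b - 1) ∈ N ∆ A ↔ edge w b ∈ N ∆ A) ∧ fru n w b (N ∆ A) = k ∧ min m (n - b) ≤ frw n w b (N ∆ A) ∧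
      ¬ (∀ i, i < b → (edge w i ∈ N ∆ A ↔ edge w 0 ∈ N ∆ A)) := by
  obtain ⟨mchg, mstop, mrun, mpart⟩ := Stair.member (m := m) hk1 hkb hbn N hN0 hNk hNw hNa hA
  refine ⟨fun h => ?_, ?_, ?_, fun h => ?_⟩
  · exact iff_not_self (h.symm.trans mchg)
  · refine fru_eq_of hb0 hbn (N ∆ A) hk1 hkb.le mrun fun _ h => ?_
    rw [← mrun (k - 1) (by omega)] at h
    exact iff_not_self (h.trans mstop)
  · exact le_frw (v := w) (a := b) hb0 hbn (N ∆ A) (Nat.min_le_right _ _) fun j hj => mpart (n - 1 - j) (by omega) (by omega) (by omega)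
  · have h1 := h (k - 1) (by omega)
    have h2 := h k hkb
    rw [← h1] at h2
    exact iff_not_self (h2.trans mstop)

/-- **Members of a staircase piece stay in the family and keep the piece data.** [this work] -/
theorem member_props {ω M : Set (Sym2 V)} (hω : ω ∈ stairFam n v a) (hM : M ∈ stairPart n v a ω) :
    M ∈ stairFam n v a ∧ (M ∈ uSet n v a ↔ ω ∈ uSet n v a) ∧ stairAlg n v a M = stairAlg n v a ω := by
  have hω' := hω
  rw [stairFam, Finset.mem_filter] at hω'
  obtain ⟨-, hchg, hfam⟩ := hω'
  rw [stairPart, Finset.mem_filter] at hM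
  obtain ⟨-, hM⟩ := hM
  obtain ⟨h1, hle, hrun, hstop⟩ := fru_spec ha0 han ω
  by_cases hu : ω ∈ uSet n v a
  · -- orientation u
    have hu' := hu
    simp only [uSet, Set.mem_setOf_eq] at hu'
    have hA0 := (top_mem_alg hn hinj hper ha0 han hω).1 hu
    rw [stairAlg, if_pos hu] at hM hA0
    obtain ⟨hT0, hTk, hTw, hTa⟩ := topU_spec hn hinj hper han (fru n v a ω) h1 hu'.1 ω
    have hA : topU n v a (fru n v a ω) ω ∆ M ∈ algOf n (lab n a (fru n v a ω) (min (fru n v a ω) (n - a + 1))) (edge v) := by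
      have : topU n v a (fru n v a ω) ω ∆ M = (topU n v a (fru n v a ω) ω ∆ ω) ∆ (M ∆ ω) := by
        rw [symmDiff_comm M ω, symmDiff_assoc, symmDiff_symmDiff_cancel_left]
      rw [this]; exact symmDiff_mem_algOf hA0 hM
    have hMeq : topU n v a (fru n v a ω) ω ∆ (topU n v a (fru n v a ω) ω ∆ M) = M := symmDiff_symmDiff_cancel_left _ M
    obtain ⟨mchg, mfru, mfrw, mmono⟩ := member_generic (n := n) ha0 han h1 hu'.1 _ _ hT0 hTk hTw hTa hA
    rw [hMeq] at mchg mfru mfrw mmono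
    have huM : M ∈ uSet n v a := by
      simp only [uSet, Set.mem_setOf_eq]
      refine ⟨by rw [mfru]; exact hu'.1, ?_⟩
      have hfle : frw n v a M ≤ n - a := Nat.min_le_left _ _
      rcases hu'.2 with h | h
      · by_cases hkq : fru n v a ω ≤ n - a
        · left; rw [mfru]
          have : min (min (fru n v a ω) (n - a + 1)) (n - a) = fru n v a ω := by
            rw [Nat.min_eq_left (by omega : fru n v a ω ≤ n - a + 1), Nat.min_eq_left hkq]
          rw [this] at mfrw; exact mfrw
        · right
          have : min (min (fru n v a ω) (n - a + 1)) (n - a) = n - a := by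
            rw [Nat.min_eq_right (by omega : n - a + 1 ≤ fru n v a ω)]; exact Nat.min_eq_right (by omega)
          rw [this] at mfrw; omega
      · by_cases hkq : fru n v a ω ≤ n - a
        · left; rw [mfru]
          have : min (min (fru n v a ω) (n - a + 1)) (n - a) = fru n v a ω := by
            rw [Nat.min_eq_left (by omega : fru n v a ω ≤ n - a + 1), Nat.min_eq_left hkq]
          rw [this] at mfrw; exact mfrw
        · right
          have : min (min (fru n v a ω) (n - a + 1)) (n - a) = n - a := by
            rw [Nat.min_eq_right (by omega : n - a + 1 ≤ fru n v a ω)]; exact Nat.min_eq_right (by omega)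
          rw [this] at mfrw; omega
    refine ⟨?_, iff_of_true huM hu, ?_⟩
    · rw [stairFam, Finset.mem_filter]
      exact ⟨Finset.mem_univ _, mchg, fun h => mmono h.1⟩
    · rw [stairAlg, stairAlg, if_pos huM, if_pos hu, mfru]
  · -- orientation w (reflected)
    obtain ⟨hwmix, hw⟩ := w_case ha0 han hfam hu
    have hk1 : 1 ≤ frw n v a ω := by
      have := (fru_spec (n := n) (v := fun i => v (n - i)) (a := n - a) (by omega) (by omega) ω).1
      rwa [← frw_eq_fru_reflect] at this
    have hA0 := (top_mem_alg hn hinj hper ha0 han hω).2 hu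
    rw [stairAlg, if_neg hu] at hM hA0
    set k := frw n v a ω with hk
    obtain ⟨hT0, hTk, hTw, hTa⟩ := topU_spec (v := fun i => v (n - i)) (a := n - a) hn (reflect_inj hinj hper) (reflect_per hper)
      (by omega) k hk1 hwmix ω
    have hA : topU n (fun i => v (n - i)) (n - a) k ω ∆ M ∈
        algOf n (lab n (n - a) k (min (k + 1) (a + 1))) (edge fun i => v (n - i)) := by
      have : topU n (fun i => v (n - i)) (n - a) k ω ∆ M = (topU n (fun i => v (n - i)) (n - a) k ω ∆ ω) ∆ (M ∆ ω) := by
        rw [symmDiff_comm M ω, symmDiff_assoc, symmDiff_symmDiff_cancel_left]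
      rw [this]; exact symmDiff_mem_algOf hA0 hM
    have hMeq : topU n (fun i => v (n - i)) (n - a) k ω ∆ (topU n (fun i => v (n - i)) (n - a) k ω ∆ M) = M :=
      symmDiff_symmDiff_cancel_left _ M
    obtain ⟨mchg, mfru, mfrw, mmono⟩ := member_generic (n := n) (w := fun i => v (n - i)) (b := n - a)
      (by omega) (by omega) hk1 hwmix _ _ hT0 hTk hTw hTa hA
    rw [hMeq] at mchg mfru mfrw mmono
    -- translate back to the original orientation
    rw [edge_reflect (by omega), edge_reflect (by omega), show n - 1 - (n - a - 1) = a by omega,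
      show n - 1 - (n - a) = a - 1 by omega] at mchg
    rw [← frw_eq_fru_reflect] at mfru
    rw [frw_reflect ha0 han, show n - (n - a) = a by omega] at mfrw
    have hnuM : M ∉ uSet n v a := by
      simp only [uSet, Set.mem_setOf_eq, not_and_or]
      by_cases hfa : fru n v a M < a
      · right
        rw [mfru]
        push Not
        refine ⟨?_, by omega⟩
        have hmin1 : min (k + 1) (a + 1) = k + 1 := Nat.min_eq_left (by omega)
        rw [hmin1] at mfrw
        by_cases h : k + 1 ≤ a
        · rw [Nat.min_eq_left h] at mfrw; omega
        · rw [Nat.min_eq_right (by omega)] at mfrw; omega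
      · left; exact hfa
    refine ⟨?_, iff_of_false hnuM hu, ?_⟩
    · rw [stairFam, Finset.mem_filter]
      refine ⟨Finset.mem_univ _, fun h => mchg h.symm, fun h => mmono fun i hi => ?_⟩
      -- the reflected u-leg is the w-leg of v: indices n-1-i ≥ a
      rw [edge_reflect (by omega), edge_reflect (by omega), Nat.sub_zero]
      exact h.2 (n - 1 - i) (by omega) (by omega)
    · rw [stairAlg, stairAlg, if_neg hnuM, if_neg hu, mfru]

omit [Fintype V] hn hinj hper ha0 han in
/-- The staircase piece algebra is closed under symmetric difference. -/
theorem stairAlg_symmDiff {ω A B : Set (Sym2 V)} (hA : A ∈ stairAlg n v a ω) (hB : B ∈ stairAlg n v a ω) : A ∆ B ∈ stairAlg n v a ω := by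
  unfold stairAlg at *
  split_ifs at * with h
  · exact symmDiff_mem_algOf hA hB
  · exact symmDiff_mem_algOf hA hB

/-- **THE STAIRCASE LEMMA (THEOREM C, step (i) of the blueprint).**  On a cycle through `s` and for a position `0 < a < n`, the antithetic sum over the
colourings that change colour at `v a` and are not one-change there is nonnegative for all increasing `F, G` of the edge cluster. [this work] -/
theorem stairFam_sum_nonneg {F G : Set (Sym2 V) → ℝ} (hF : Monotone F) (hG : Monotone G) :
    0 ≤ ∑ ω ∈ stairFam n v a, Peel.delta F G (edgeSet n v) (v 0) ω := by
  refine sum_nonneg_of_parts (stairFam n v a) _ (stairPart n v a) (fun ω _ => ?_) (fun ω hω M hM => ?_) (fun ω hω M hM => ?_)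
    (fun ω hω => ?_)
  · rw [stairPart, Finset.mem_filter, symmDiff_self]
    refine ⟨Finset.mem_univ _, ?_⟩
    unfold stairAlg; split_ifs <;> exact empty_mem_algOf
  · exact (member_props hn hinj hper ha0 han hω hM).1
  · obtain ⟨-, -, halg⟩ := member_props hn hinj hper ha0 han hω hM
    rw [stairPart, Finset.mem_filter] at hM
    ext M'
    rw [stairPart, stairPart, Finset.mem_filter, Finset.mem_filter, halg]
    have key : ∀ X : Set (Sym2 V), X ∆ M = (X ∆ ω) ∆ (M ∆ ω) := fun X => by
      rw [symmDiff_comm M ω, symmDiff_assoc, symmDiff_symmDiff_cancel_left]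
    constructor
    · rintro ⟨-, h⟩
      refine ⟨Finset.mem_univ _, ?_⟩
      have : M' ∆ ω = (M' ∆ M) ∆ (M ∆ ω) := by rw [symmDiff_assoc, symmDiff_symmDiff_cancel_left]
      rw [this]; exact stairAlg_symmDiff h hM.2
    · rintro ⟨-, h⟩
      exact ⟨Finset.mem_univ _, by rw [key]; exact stairAlg_symmDiff h hM.2⟩
  · -- the part is the image of its algebra under `N ∆ ·`; apply the staircase piece lemma in the right orientation
    have hω' := hω
    rw [stairFam, Finset.mem_filter] at hω'
    obtain ⟨-, hchg, hfam⟩ := hω'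
    obtain ⟨h1, hle, -, -⟩ := fru_spec ha0 han ω
    by_cases hu : ω ∈ uSet n v a
    · have hu' := hu
      simp only [uSet, Set.mem_setOf_eq] at hu'
      have hA0 := (top_mem_alg hn hinj hper ha0 han hω).1 hu
      rw [stairAlg, if_pos hu] at hA0
      obtain ⟨hT0, hTk, hTw, hTa⟩ := topU_spec hn hinj hper han (fru n v a ω) h1 hu'.1 ω
      have hpart : stairPart n v a ω = (Finset.univ.filter fun A : Set (Sym2 V) =>
          ∀ i j, i < n → j < n → lab n a (fru n v a ω) (min (fru n v a ω) (n - a + 1)) i = lab n a (fru n v a ω) (min (fru n v a ω) (n - a + 1)) j →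
            (edge v i ∈ A ↔ edge v j ∈ A)).image (topU n v a (fru n v a ω) ω ∆ ·) := by
        rw [stairPart]
        have : (Finset.univ.filter fun M : Set (Sym2 V) => M ∆ ω ∈ stairAlg n v a ω) =
            Finset.univ.filter fun M : Set (Sym2 V) => M ∆ ω ∈ algOf n (lab n a (fru n v a ω) (min (fru n v a ω) (n - a + 1))) (edge v) :=
          Finset.filter_congr fun M _ => by rw [stairAlg, if_pos hu]
        rw [this, filter_eq_image hA0]
        congr 1
      rw [hpart]
      exact Stair.sum_nonneg hn hinj hper h1 hu'.1 han _ hT0 hTk hTw hTa hF hG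
    · obtain ⟨hwmix, hw⟩ := w_case ha0 han hfam hu
      have hk1 : 1 ≤ frw n v a ω := by
        have := (fru_spec (n := n) (v := fun i => v (n - i)) (a := n - a) (by omega) (by omega) ω).1
        rwa [← frw_eq_fru_reflect] at this
      have hA0 := (top_mem_alg hn hinj hper ha0 han hω).2 hu
      rw [stairAlg, if_neg hu] at hA0
      obtain ⟨hT0, hTk, hTw, hTa⟩ := topU_spec (v := fun i => v (n - i)) (a := n - a) hn (reflect_inj hinj hper) (reflect_per hper)
        (by omega) (frw n v a ω) hk1 hwmix ω
      have hpart : stairPart n v a ω = (Finset.univ.filter fun A : Set (Sym2 V) =>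
          ∀ i j, i < n → j < n → lab n (n - a) (frw n v a ω) (min (frw n v a ω + 1) (a + 1)) i =
            lab n (n - a) (frw n v a ω) (min (frw n v a ω + 1) (a + 1)) j →
            (edge (fun i => v (n - i)) i ∈ A ↔ edge (fun i => v (n - i)) j ∈ A)).image (topU n (fun i => v (n - i)) (n - a) (frw n v a ω) ω ∆ ·) := by
        rw [stairPart]
        have : (Finset.univ.filter fun M : Set (Sym2 V) => M ∆ ω ∈ stairAlg n v a ω) =
            Finset.univ.filter fun M : Set (Sym2 V) => M ∆ ω ∈
              algOf n (lab n (n - a) (frw n v a ω) (min (frw n v a ω + 1) (a + 1))) (edge fun i => v (n - i)) :=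
          Finset.filter_congr fun M _ => by rw [stairAlg, if_neg hu]
        rw [this, filter_eq_image hA0]
        congr 1
      rw [hpart]
      have h := Stair.sum_nonneg (v := fun i => v (n - i)) (a := n - a) (m := min (frw n v a ω + 1) (a + 1)) hn (reflect_inj hinj hper)
        (reflect_per hper) hk1 hwmix (by omega) _ hT0 hTk hTw hTa hF hG
      rw [edgeSet_reflect] at h
      simpa only [Nat.sub_zero, hper] using h

end Main

end Cyc

end Antithetic

end Summit.CriticalPhenomena.PercolationContinuityZ3.Theorems
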